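import Literature.MathematicalPhysics.KineticTheory.VelocityBlindPlacementStatements
import HarnessLib

/-!
# The split window transfer to contact chaos: clipped pull-back, clipped tube main term, collision-sampled pool excess

Topic `Literature/MathematicalPhysics/KineticTheory`; second companion of `VelocityBlindPlacement.lean` /
`VelocityBlindPlacementStatements.lean` for the crux line `Sketch` (idea `velocity-blind-placement`) on
`InformationPercolationEngine.PercolationClosesChaos` (stmt-AtomisticToContinuum-14915; lead
`prover-line-stmt-AtomisticToContinuum-14915-0`).  Three statements (`def … : Prop`, never asserted here) in the
quantifier format of the route target `ContactChaos` (stmt-13477), over the tree vocabulary `collisionSum`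
(`EvenCollisionTubeFunctional`), `tubeTimeStat` (`CollisionTubeFunctional`), `coneKernel`, `sphereMark`,
`empiricalMeasure`, by which the line's window transfer `VBP₂ → NCGiso → NCGcv → LMP → TM → WCM → CPE → ContactChaos`
is SPLIT into two pieces with a proved assembly (problem-side, `Theorems/…TransferSplit`):

* the weight of both pieces is the target's localiser times the CLIPPED time-mollified `r`-pool pair field,
  `χ̃ᴮ(s, x) = χ(s, x) · clip_B (Pm_r(Θ Th)(z, s, x))`, `clip_B y = max (min y B) (−B)`,
  `Pm_r(Θ Th)(z, s₀, x₀) = ∫_{[0,τ]} r⁻¹(1 − |s − s₀|/r)₊ ∫∫ b_r(y, x₀) b_r(y', x₀) Θ(Th)(v, v') dμ_s dμ_s ds`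
  (verbatim the target's `Pm (Θ Th)`), and the collision marks are cut in velocity by
  `cut_L(v, v') = (min(L − max(‖v‖, ‖v'‖), 1))₊`;
1. `ClippedPullbackInProbability` (PBP) — the clipped weighted collision sum `K_N[χ̃ᴮ · Ξ]` is within `η` of the
   time-integrated tube functional `∫₀^τ A_t[χ̃ᴮ, Ξ cut_L] dt` at tube length `a ℓ_N` (`κ = a/(πσ³)`) outside
   measure `≤ δ`, order `∀ B ∀ η δ ∃ L₀ ∀ L ≥ L₀ ∃ a₁ ∀ a < a₁ ∀ r > 0 ∃ N₀ ∀ N ≥ N₀` (Boltzmann's collision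
   cylinder along one orbit, CIP 1994 §2.2 / App. 4.A, plus window collision moments; PROVED problem-side from
   `WindowCollisionMoments`);
2. `ClippedTubeMainTerm` (MT) — the two clipped tube functionals of the target (weights `χ̃ᴮ(Θ 1)`, `χ̃ᴮ(Θ Ψ)`,
   marks `Ψ cut_L`, `1 cut_L`) differ by `≤ η` outside measure `≤ δ`, order
   `∀ B ∀ L ≥ 1 ∀ η δ ∃ a₁ ∀ a ∃ r₀ ∀ r ∃ N₀ ∀ N` (the snapshot part: placement, isotropy, contact value, local
   Maxwellian, temporal coherence; open);
3. `CollisionPoolExcess` (CPE) — the collision sum sees the pool pair field only up to a level `B(η, δ)` chosen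
   BEFORE `r`: `K_N[χ Pm; Ξ] − K_N[χ clip_B Pm; Ξ] → 0` in probability, order `∀ η δ ∃ B₀ ∀ B ≥ B₀ ∃ r₀ ∀ r ∃ N₀ ∀ N`
   (a pool-weighted window collision moment: the remainders of the pull-back are `sup|weight| × o_a(1)` while
   `sup |Pm_r|` on the energy shell diverges as `r → 0`; open, WCM-class).

## References (design sources; the statements are constructions of this programme, tagged `[folklore]`)

* C. Cercignani, R. Illner, M. Pulvirenti, *The Mathematical Theory of Dilute Gases* (1994), §2.2, §2.3, §4.4,
  App. 4.A. [CIP1994]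
* H. Spohn, *Large Scale Dynamics of Interacting Particles* (1991), Part I Ch. 3. [Spohn1991]
* O. E. Lanford, *Time evolution of large classical systems* (1975). [Lanford1975]

## Not here

No claim that any of the three holds; the proof of PBP from `WindowCollisionMoments`, the assembly and the
composition are problem-side.
-/

noncomputable section

open MeasureTheory Set
open scoped ENNReal BigOperators
open Literature.Analysis.FluidPDE

namespace Literature.MathematicalPhysics.KineticTheory

namespace VelocityBlindPlacement

/-- **PBP — clipped pull-back in probability.** For continuous positive profiles there is `σ₀ > 0` such that for
`0 < σ < σ₀`, every flow family, horizon `τ > 0`, continuous localiser `χ`, bounded continuous pair mark `Th`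
and collision mark `Ξ`, clipping level `B > 0` and accuracy `η, δ > 0`, there is a velocity cut `L₀ ≥ 1` such
that for every `L ≥ L₀` some `a₁ > 0` makes, for all tube lengths `a ∈ (0, a₁)`, radii `r > 0` and `N ≥ N₀`,
the clipped weighted collision sum `K_N[(χ · clip_B Pm_r(Θ Th)) · 1 · Ξ]` lie within `η` of the time-integrated
tube functional with the same weight, cut mark `Ξ · cut_L` and flight-time parameter `κ = a/(πσ³)`, outside an
event of `localGibbsLaw`-measure `≤ δ` (CIP 1994 §2.2, App. 4.A read along one orbit). [folklore] -/
def ClippedPullbackInProbability : Prop :=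
  ∀ (a₀ θ₀ : T3 → ℝ) (u₀ : T3 → V3), Continuous a₀ → Continuous θ₀ → Continuous u₀ →
    (∀ x, 0 < a₀ x) → (∀ x, 0 < θ₀ x) →
    ∃ σ₀ : ℝ, 0 < σ₀ ∧ ∀ σ : ℝ, 0 < σ → σ < σ₀ → ∀ Φ : (N : ℕ) → Flow σ N, ∀ τ : ℝ, 0 < τ →
      ∀ χ : ℝ × T3 → ℝ, Continuous χ →
      ∀ Th : V3 × V3 × V3 → ℝ, Continuous Th → (∃ C : ℝ, ∀ p, |Th p| ≤ C) →
      ∀ Ξ : V3 × V3 × V3 → ℝ, Continuous Ξ → (∃ C : ℝ, ∀ p, |Ξ p| ≤ C) →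
      ∀ B : ℝ, 0 < B → ∀ η δ : ℝ, 0 < η → 0 < δ →
      ∃ L₀ : ℝ, 1 ≤ L₀ ∧ ∀ L : ℝ, L₀ ≤ L → ∃ a₁ : ℝ, 0 < a₁ ∧ ∀ a : ℝ, 0 < a → a < a₁ →
      ∀ r : ℝ, 0 < r → ∃ N₀ : ℕ, ∀ N : ℕ, N₀ ≤ N →
        localGibbsLaw σ a₀ u₀ θ₀ N (Φ N)
          {z | η < |Literature.MathematicalPhysics.KineticTheory.collisionSum σ N (Φ N) τ
                (fun p => χ p * max (min (∫ s in Icc (0 : ℝ) τ, r⁻¹ * max (1 - |s - p.1| / r) 0 *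
                  ∫ q, coneKernel r q.1.1 p.2 * coneKernel r q.2.1 p.2 * sphereMark Th q.1.2 q.2.2
                    ∂((empiricalMeasure ((Φ N).flow s z)).prod (empiricalMeasure ((Φ N).flow s z)))) B) (-B))
                (fun _ => 1) Ξ 1 z -
              tubeTimeStat σ N (Φ N) τ
                (fun p => χ p * max (min (∫ s in Icc (0 : ℝ) τ, r⁻¹ * max (1 - |s - p.1| / r) 0 *
                  ∫ q, coneKernel r q.1.1 p.2 * coneKernel r q.2.1 p.2 * sphereMark Th q.1.2 q.2.2
                    ∂((empiricalMeasure ((Φ N).flow s z)).prod (empiricalMeasure ((Φ N).flow s z)))) B) (-B))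
                (fun _ => 1) (fun p => Ξ p * max (min (L - max ‖p.2.1‖ ‖p.2.2‖) 1) 0) 1 1 1
                (a / (Real.pi * σ ^ 3)) z|} ≤ ENNReal.ofReal δ

/-- **MT — clipped tube main term.** For every clipping level `B`, velocity cut `L ≥ 1` and accuracy, the two
clipped time-integrated tube functionals of the target (weights `χ · clip_B Pm(Θ 1)`, `χ · clip_B Pm(Θ Ψ)`; marks
`Ψ · cut_L`, `1 · cut_L`; tube length `a ℓ_N`) differ by `≤ η` outside measure `≤ δ`; order
`∀ B ∀ L ∀ η δ ∃ a₁ ∀ a ∈ (0,a₁) ∃ r₀ ∀ r ∈ (0,r₀) ∃ N₀ ∀ N ≥ N₀` (the snapshot content of the transfer: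
test-function extension, indicator sandwich, cylinder evaluation, cross-ratio cancellation with the SAME
empirical scalar, pool identification). Open. [folklore] -/
def ClippedTubeMainTerm : Prop :=
  ∀ (a₀ θ₀ : T3 → ℝ) (u₀ : T3 → V3), Continuous a₀ → Continuous θ₀ → Continuous u₀ →
    (∀ x, 0 < a₀ x) → (∀ x, 0 < θ₀ x) →
    ∃ σ₀ : ℝ, 0 < σ₀ ∧ ∀ σ : ℝ, 0 < σ → σ < σ₀ → ∀ Φ : (N : ℕ) → Flow σ N, ∀ τ : ℝ, 0 < τ →
      ∀ χ : ℝ × T3 → ℝ, Continuous χ →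
      ∀ Ψ : V3 × V3 × V3 → ℝ, Continuous Ψ → (∃ C : ℝ, ∀ p, |Ψ p| ≤ C) →
      ∀ B : ℝ, 0 < B → ∀ L : ℝ, 1 ≤ L → ∀ η δ : ℝ, 0 < η → 0 < δ →
      ∃ a₁ : ℝ, 0 < a₁ ∧ ∀ a : ℝ, 0 < a → a < a₁ → ∃ r₀ : ℝ, 0 < r₀ ∧ ∀ r : ℝ, 0 < r → r < r₀ →
      ∃ N₀ : ℕ, ∀ N : ℕ, N₀ ≤ N →
        localGibbsLaw σ a₀ u₀ θ₀ N (Φ N)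
          {z | η < |tubeTimeStat σ N (Φ N) τ
                (fun p => χ p * max (min (∫ s in Icc (0 : ℝ) τ, r⁻¹ * max (1 - |s - p.1| / r) 0 *
                  ∫ q, coneKernel r q.1.1 p.2 * coneKernel r q.2.1 p.2 * sphereMark (fun _ => 1) q.1.2 q.2.2
                    ∂((empiricalMeasure ((Φ N).flow s z)).prod (empiricalMeasure ((Φ N).flow s z)))) B) (-B))
                (fun _ => 1) (fun p => Ψ p * max (min (L - max ‖p.2.1‖ ‖p.2.2‖) 1) 0) 1 1 1
                (a / (Real.pi * σ ^ 3)) z -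
              tubeTimeStat σ N (Φ N) τ
                (fun p => χ p * max (min (∫ s in Icc (0 : ℝ) τ, r⁻¹ * max (1 - |s - p.1| / r) 0 *
                  ∫ q, coneKernel r q.1.1 p.2 * coneKernel r q.2.1 p.2 * sphereMark Ψ q.1.2 q.2.2
                    ∂((empiricalMeasure ((Φ N).flow s z)).prod (empiricalMeasure ((Φ N).flow s z)))) B) (-B))
                (fun _ => 1) (fun p => (1 : ℝ) * max (min (L - max ‖p.2.1‖ ‖p.2.2‖) 1) 0) 1 1 1
                (a / (Real.pi * σ ^ 3)) z|} ≤ ENNReal.ofReal δ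

/-- **CPE — collision-sampled pool excess.** For continuous localiser `χ`, bounded continuous pair mark `Th` and
collision mark `Ξ`, and accuracy `η, δ`, there is a clipping level `B₀ > 0` such that for every `B ≥ B₀`, small
`r` and large `N`, the collision sums with weights `χ · Pm_r(Θ Th)` and `χ · clip_B Pm_r(Θ Th)` (and mark `Ξ`) differ
by `≤ η` outside measure `≤ δ`: the collisions of the orbit sample the time-mollified pool pair field only up to a
level independent of `r` (a pool-weighted window collision moment; it follows from tightness of `K_N[Pm_r²]`
uniformly in `r`, or from a local kinetic-density cap along the flow). Open (standard-in-print class under the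
invariant law). [folklore] -/
def CollisionPoolExcess : Prop :=
  ∀ (a₀ θ₀ : T3 → ℝ) (u₀ : T3 → V3), Continuous a₀ → Continuous θ₀ → Continuous u₀ →
    (∀ x, 0 < a₀ x) → (∀ x, 0 < θ₀ x) →
    ∃ σ₀ : ℝ, 0 < σ₀ ∧ ∀ σ : ℝ, 0 < σ → σ < σ₀ → ∀ Φ : (N : ℕ) → Flow σ N, ∀ τ : ℝ, 0 < τ →
      ∀ χ : ℝ × T3 → ℝ, Continuous χ →
      ∀ Th : V3 × V3 × V3 → ℝ, Continuous Th → (∃ C : ℝ, ∀ p, |Th p| ≤ C) →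
      ∀ Ξ : V3 × V3 × V3 → ℝ, Continuous Ξ → (∃ C : ℝ, ∀ p, |Ξ p| ≤ C) →
      ∀ η δ : ℝ, 0 < η → 0 < δ → ∃ B₀ : ℝ, 0 < B₀ ∧ ∀ B : ℝ, B₀ ≤ B →
      ∃ r₀ : ℝ, 0 < r₀ ∧ ∀ r : ℝ, 0 < r → r < r₀ → ∃ N₀ : ℕ, ∀ N : ℕ, N₀ ≤ N →
        localGibbsLaw σ a₀ u₀ θ₀ N (Φ N)
          {z | η < |Literature.MathematicalPhysics.KineticTheory.collisionSum σ N (Φ N) τ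
                (fun p => χ p * ∫ s in Icc (0 : ℝ) τ, r⁻¹ * max (1 - |s - p.1| / r) 0 *
                  ∫ q, coneKernel r q.1.1 p.2 * coneKernel r q.2.1 p.2 * sphereMark Th q.1.2 q.2.2
                    ∂((empiricalMeasure ((Φ N).flow s z)).prod (empiricalMeasure ((Φ N).flow s z))))
                (fun _ => 1) Ξ 1 z -
              Literature.MathematicalPhysics.KineticTheory.collisionSum σ N (Φ N) τ
                (fun p => χ p * max (min (∫ s in Icc (0 : ℝ) τ, r⁻¹ * max (1 - |s - p.1| / r) 0 *
                  ∫ q, coneKernel r q.1.1 p.2 * coneKernel r q.2.1 p.2 * sphereMark Th q.1.2 q.2.2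
                    ∂((empiricalMeasure ((Φ N).flow s z)).prod (empiricalMeasure ((Φ N).flow s z)))) B) (-B))
                (fun _ => 1) Ξ 1 z|} ≤ ENNReal.ofReal δ

end VelocityBlindPlacement

end Literature.MathematicalPhysics.KineticTheory

end
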